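import Literature.MathematicalPhysics.QuantumLattice.HubbardTTPrimePhaseCoexistenceExclusionGrandCanonical
import Literature.MathematicalPhysics.QuantumLattice.HubbardTTPrimeSourcedParticleHole
import Literature.MathematicalPhysics.QuantumLattice.ParticleHoleStatesHalfFilling
import HarnessLib

/-!
# Particle–hole reflection of grand-canonical EQUILIBRIUM STATES of the 2D `t–t'` Hubbard model at `T > 0`: an equilibrium of `H(t,t',U) − μN`
# at `β` is carried to an equilibrium of `H(t,−t',U) − (U − μ)N` at `β` with density `2 − ρ` — and the `μ`-axis competing-order laws transfer to
# the ELECTRON-DOPED side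

Topic `Literature/MathematicalPhysics/QuantumLattice` (family `hubbard`; cell `pub/hubbard-downfold`, MO-S1 ↔ S2 seam «box ↦ one word», filling direction
= the Legendre pair `μ ↔ n`, reflection `μ ↦ U − μ`; written 2026-08-28 by hubbard-downfold-unc-2 g23). The tree has the `T = 0` state-level reflection
for the `μ`-pencil (`IsMeanEnergyMinimiser.particleHole_tPrime`: minimisers at `(t', μ)` ↦ minimisers at `(−t', U − μ)`), the `T > 0` reflection for the
nearest-neighbour model in any dimension (`IsVarEquilibrium.particleHole_hubbardZeeman`), the invariance of the mean entropy (`entropyDensitySup_particleHole`)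
and the `t–t'` mean-energy identity `e^{t,t',U}(ω ∘ α) = e^{t,−t',U}(ω) + U(1 − ρ(ω))` (`IsTranslationInvariant.meanEnergy_hubbardTTPrime_particleHole`). This
file supplies the `T > 0` state-level reflection for the `t–t'` model, for ANY pair of `μ`-shifts (`e_Γ = e_{Φ(t,t',U)} − μρ`, `e_{Γ'} = e_{Φ(t,−t',U)} − (U − μ)ρ`;
e.g. the pencils `hubbardTTPrimeMuInteraction`, `gcInteractionTT' … 0`):

* `IsTranslationInvariant.meanEnergy_particleHole_of_muShift_reflect` — `e_{Γ'}(ω ∘ α) = e_Γ(ω) + (2μ − U)` for translation-invariant `ω`;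
* `varPressure_reflect_eq_of_muShift` — `P(β, Γ') = P(β, Γ) − β(2μ − U)`;
* **`IsVarEquilibrium.particleHole_of_muShift_reflect`** — `ω` an equilibrium of `Γ` at `β` ⇒ `ω ∘ α` an equilibrium of `Γ'` at `β` (density `2 − ρ(ω)`);
  the iff `isVarEquilibrium_particleHole_iff_of_muShift_reflect`.
* §2 the TRANSFER of the one-`μ` exclusion and of the `Δμ` gap to the electron-doped side (`d = 2`, model `Φ(t,t',U)` from sentences about `Φ(t,−t',U)`):
  `not_isVarEquilibrium_electronDoped_of_holeDoped` and `sub_chemPot_electronDoped_of_holeDoped` — generic in the hole-side sentence, so every typed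
  registry / cell sentence has an electron-doped `μ`-axis edition by one `exact` (instances: `Observables/PhaseSeparationExclusionU8GrandCanonicalElectronDopedThermal`).

HONEST SCOPE: exact symmetry transport — no new information about the model; translation-invariant variational equilibria; no number, no named fact,
no definition. Everything is PROVED, 0 sorry.

## Mathlib / tree search
REUSED: `InfVolFermionState.particleHole`, `particleHole_particleHole`, `density_particleHole`, `IsTranslationInvariant.particleHole`, `IsTranslationInvariant.isEven`
(`InfVolFermionStateParticleHole`, `TranslationInvariantFermionStatesAreEven`); `IsTranslationInvariant.meanEnergy_hubbardTTPrime_particleHole`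
(`HubbardTTPrimeSourcedParticleHole`); `entropyDensitySup_particleHole` (`ParticleHoleStatesHalfFilling`); `IsVarEquilibrium`, `varPressure_le`,
`sub_mul_le_varPressure` (`TIVariationalPressure`). `lean search 'IsVarEquilibrium.*particleHole.*tPrime|particleHole.*gcInteractionTT'` (2026-08-28): only the
`T = 0` pencil reflection and the nearest-neighbour `hubbardZeeman` one.

## References
* E. H. Lieb, Phys. Rev. Lett. 62 (1989) 1201, proof of Theorem 2 (the particle–hole transformation). [cite: LiebPRL1989, proof of Theorem 2]
* E. H. Lieb, F. Y. Wu, Physica A 321 (2003) 1, §1 eq. (3). [cite: LiebWuPhysicaA2003, §1 eq. (3)]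
* R. B. Israel, *Convexity in the Theory of Lattice Gases* (1979), Thm. I.2.4, §IV.2. [cite: Israel1979, Thm. I.2.4]
* O. Bratteli, D. W. Robinson, *OAQSM 2* (1997), Prop. 6.2.15 (entropy invariant under quasi-local automorphisms). [cite: BratteliRobinsonII1997, Prop. 6.2.15]
-/

noncomputable section

open scoped ComplexOrder BigOperators

namespace Literature.MathematicalPhysics.QuantumLattice

open Matrix HubbardWave0 Literature.Probability.LatticeModels ThermodynamicLimit InfVolFermionState FermionInteraction Set

namespace InfVolFermionState

/-! ## §1 The reflection of equilibrium states -/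

section Reflect

variable (t t' U : ℝ) (β : ℝ) {Γ Γ' : FermionInteraction 2} {R R' μ : ℝ} {ω : InfVolFermionState 2}

/-- **`e_{Γ'}(ω ∘ α) = e_Γ(ω) + (2μ − U)`** for translation-invariant `ω`, where `Γ` is a `μ`-shift of `Φ(t,t',U)` and `Γ'` a `(U − μ)`-shift of
`Φ(t,−t',U)`. [cite: LiebPRL1989, proof of Theorem 2] [cite: LiebWuPhysicaA2003, §1 eq. (3)] -/
theorem IsTranslationInvariant.meanEnergy_particleHole_of_muShift_reflect (hω : ω.IsTranslationInvariant)
    (hΓ : ∀ σ : InfVolFermionState 2, σ.meanEnergy Γ R = σ.meanEnergy (hubbardTTPrimeFermionInteraction t t' U) 1 - μ * σ.density)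
    (hΓ' : ∀ σ : InfVolFermionState 2, σ.meanEnergy Γ' R' =
      σ.meanEnergy (hubbardTTPrimeFermionInteraction t (-t') U) 1 - (U - μ) * σ.density) :
    ω.particleHole.meanEnergy Γ' R' = ω.meanEnergy Γ R + (2 * μ - U) := by
  have key := hω.meanEnergy_hubbardTTPrime_particleHole t (-t') U
  rw [neg_neg] at key
  rw [hΓ', hΓ, key, density_particleHole]
  ring

/-- **The variational pressures of the reflected pair differ by the constant**: `P(β, Γ') = P(β, Γ) − β(2μ − U)` (the reflection `ω ↦ ω ∘ α` is an
involution of the translation-invariant states preserving the mean entropy). [cite: Israel1979, Thm. I.2.4] [cite: BratteliRobinsonII1997, Prop. 6.2.15] -/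
theorem varPressure_reflect_eq_of_muShift
    (hΓ : ∀ σ : InfVolFermionState 2, σ.meanEnergy Γ R = σ.meanEnergy (hubbardTTPrimeFermionInteraction t t' U) 1 - μ * σ.density)
    (hΓ' : ∀ σ : InfVolFermionState 2, σ.meanEnergy Γ' R' =
      σ.meanEnergy (hubbardTTPrimeFermionInteraction t (-t') U) 1 - (U - μ) * σ.density) :
    Γ'.varPressure β R' = Γ.varPressure β R - β * (2 * μ - U) := by
  refine le_antisymm ?_ ?_
  · refine Γ'.varPressure_le β R' fun σ hσ => ?_
    have hσ' : σ.particleHole.IsTranslationInvariant := hσ.particleHole (hσ.isEven two_pos)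
    -- `σ = (σ ∘ α) ∘ α`
    have e1 := hσ'.meanEnergy_particleHole_of_muShift_reflect t t' U hΓ hΓ'
    rw [particleHole_particleHole] at e1
    have hs := σ.particleHole.entropyDensitySup_particleHole
    rw [particleHole_particleHole] at hs
    have h := Γ.sub_mul_le_varPressure β R hσ'
    rw [e1, hs]
    have e2 : β * (σ.particleHole.meanEnergy Γ R + (2 * μ - U)) = β * σ.particleHole.meanEnergy Γ R + β * (2 * μ - U) := by ring
    rw [e2]
    linarith
  · have h : Γ.varPressure β R ≤ Γ'.varPressure β R' + β * (2 * μ - U) := by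
      refine Γ.varPressure_le β R fun σ hσ => ?_
      have hσ' : σ.particleHole.IsTranslationInvariant := hσ.particleHole (hσ.isEven two_pos)
      have e1 := hσ.meanEnergy_particleHole_of_muShift_reflect t t' U hΓ hΓ'
      have hs := σ.entropyDensitySup_particleHole
      have h := Γ'.sub_mul_le_varPressure β R' hσ'
      rw [e1, hs] at h
      have e2 : β * (σ.meanEnergy Γ R + (2 * μ - U)) = β * σ.meanEnergy Γ R + β * (2 * μ - U) := by ring
      rw [e2] at h
      linarith
    linarith

/-- **PARTICLE–HOLE REFLECTION OF EQUILIBRIUM STATES (`t–t'`, `T > 0`).** If `ω` is a translation-invariant variational equilibrium of `Γ`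
(`e_Γ = e_{Φ(t,t',U)} − μρ`) at `β`, then `ω ∘ α` is one of `Γ'` (`e_{Γ'} = e_{Φ(t,−t',U)} − (U − μ)ρ`) at `β`; its density is `2 − ρ(ω)`.
[cite: LiebPRL1989, proof of Theorem 2] [cite: Israel1979, Thm. I.2.4] -/
theorem IsVarEquilibrium.particleHole_of_muShift_reflect (h : ω.IsVarEquilibrium β Γ R)
    (hΓ : ∀ σ : InfVolFermionState 2, σ.meanEnergy Γ R = σ.meanEnergy (hubbardTTPrimeFermionInteraction t t' U) 1 - μ * σ.density)
    (hΓ' : ∀ σ : InfVolFermionState 2, σ.meanEnergy Γ' R' =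
      σ.meanEnergy (hubbardTTPrimeFermionInteraction t (-t') U) 1 - (U - μ) * σ.density) :
    ω.particleHole.IsVarEquilibrium β Γ' R' := by
  refine ⟨h.1.particleHole (h.1.isEven two_pos), ?_⟩
  rw [h.1.meanEnergy_particleHole_of_muShift_reflect t t' U hΓ hΓ', ω.entropyDensitySup_particleHole,
    varPressure_reflect_eq_of_muShift t t' U β hΓ hΓ', ← h.2]
  ring

/-- **… and conversely** (`α` is an involution and `−(−t') = t'`, `U − (U − μ) = μ`): `ω ∘ α` is an equilibrium of `Γ'` iff `ω` is one of `Γ`.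
[cite: LiebPRL1989, proof of Theorem 2] [cite: Israel1979, Thm. I.2.4] -/
theorem isVarEquilibrium_particleHole_iff_of_muShift_reflect
    (hΓ : ∀ σ : InfVolFermionState 2, σ.meanEnergy Γ R = σ.meanEnergy (hubbardTTPrimeFermionInteraction t t' U) 1 - μ * σ.density)
    (hΓ' : ∀ σ : InfVolFermionState 2, σ.meanEnergy Γ' R' =
      σ.meanEnergy (hubbardTTPrimeFermionInteraction t (-t') U) 1 - (U - μ) * σ.density) :
    ω.particleHole.IsVarEquilibrium β Γ' R' ↔ ω.IsVarEquilibrium β Γ R := by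
  refine ⟨fun h => ?_, fun h => h.particleHole_of_muShift_reflect t t' U β hΓ hΓ'⟩
  have hΓ'' : ∀ σ : InfVolFermionState 2, σ.meanEnergy Γ R =
      σ.meanEnergy (hubbardTTPrimeFermionInteraction t (-(-t')) U) 1 - (U - (U - μ)) * σ.density := by
    intro σ; rw [neg_neg, sub_sub_cancel]; exact hΓ σ
  have k := h.particleHole_of_muShift_reflect t (-t') U β hΓ' hΓ''
  rwa [particleHole_particleHole] at k

end Reflect

/-! ## §2 Transfer of `μ`-axis sentences to the electron-doped side -/

section Transfer

variable (t t' U : ℝ) (β : ℝ) {Γ Γ₁ Γ₂ : FermionInteraction 2} {R₀ R₁ R₂ μ μ₁ μ₂ : ℝ} {ω₁ ω₂ : InfVolFermionState 2}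

/-- **One-`(β, μ)` exclusion, electron-doped edition from the hole-doped one.** Suppose that for the model `Φ(t,−t',U)` at the reflected chemical
potential `U − μ`, every pair of `(U − μ)`-shift equilibria with densities `≤ 2 − m₂` and `≥ 2 − m₁` is contradictory (the hole-side sentence `H`, stated for
the pencil `hubbardTTPrimeMuInteraction t (−t') U (U − μ)`). Then for `Φ(t,t',U)` at `μ` (any `Γ` with `e_Γ = e_Φ − μρ`): an equilibrium of density `≤ m₁`
excludes every equilibrium of density `≥ m₂`. [cite: LiebPRL1989, proof of Theorem 2] [cite: Israel1979, Thm. I.2.4] -/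
theorem not_isVarEquilibrium_electronDoped_of_holeDoped {m₁ m₂ : ℝ}
    (H : ∀ {σ₁ σ₂ : InfVolFermionState 2}, σ₁.IsVarEquilibrium β (hubbardTTPrimeMuInteraction t (-t') U (U - μ)) 1 →
      σ₁.density ≤ 2 - m₂ → 2 - m₁ ≤ σ₂.density → ¬ σ₂.IsVarEquilibrium β (hubbardTTPrimeMuInteraction t (-t') U (U - μ)) 1)
    (hΓ : ∀ σ : InfVolFermionState 2, σ.meanEnergy Γ R₀ = σ.meanEnergy (hubbardTTPrimeFermionInteraction t t' U) 1 - μ * σ.density)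
    (hω₁ : ω₁.IsVarEquilibrium β Γ R₀) (hρ₁ : ω₁.density ≤ m₁) (hρ₂ : m₂ ≤ ω₂.density) :
    ¬ ω₂.IsVarEquilibrium β Γ R₀ := by
  intro hω₂
  have hΓ' := meanEnergy_hubbardTTPrimeMu_eq_sub t (-t') U (U - μ)
  have k₁ := hω₁.particleHole_of_muShift_reflect t t' U β hΓ hΓ'
  have k₂ := hω₂.particleHole_of_muShift_reflect t t' U β hΓ hΓ'
  have hd₁ : 2 - m₁ ≤ ω₁.particleHole.density := by rw [density_particleHole]; linarith
  have hd₂ : ω₂.particleHole.density ≤ 2 - m₂ := by rw [density_particleHole]; linarith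
  exact H k₂ hd₂ hd₁ k₁

/-- **`Δμ` gap, electron-doped edition from the hole-doped one.** Suppose the hole-side sentence for `Φ(t,−t',U)`: any `ν₁` carrying a pencil equilibrium
of density `≤ 2 − m₂` and any `ν₂` carrying one of density `≥ 2 − m₁` obey `g ≤ ν₂ − ν₁`. Then for `Φ(t,t',U)`: any `μ₁` carrying an equilibrium of density
`≤ m₁` (shift `Γ₁`) and any `μ₂` carrying one of density `≥ m₂` (shift `Γ₂`) obey `g ≤ μ₂ − μ₁` (`ν₁ = U − μ₂`, `ν₂ = U − μ₁`).
[cite: LiebPRL1989, proof of Theorem 2] [cite: Israel1979, Thm. I.2.4] -/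
theorem sub_chemPot_electronDoped_of_holeDoped {m₁ m₂ g : ℝ}
    (H : ∀ {ν₁ ν₂ : ℝ} {σ₁ σ₂ : InfVolFermionState 2},
      σ₁.IsVarEquilibrium β (hubbardTTPrimeMuInteraction t (-t') U ν₁) 1 → σ₁.density ≤ 2 - m₂ →
      σ₂.IsVarEquilibrium β (hubbardTTPrimeMuInteraction t (-t') U ν₂) 1 → 2 - m₁ ≤ σ₂.density → g ≤ ν₂ - ν₁)
    (hΓ₁ : ∀ σ : InfVolFermionState 2, σ.meanEnergy Γ₁ R₁ = σ.meanEnergy (hubbardTTPrimeFermionInteraction t t' U) 1 - μ₁ * σ.density)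
    (hΓ₂ : ∀ σ : InfVolFermionState 2, σ.meanEnergy Γ₂ R₂ = σ.meanEnergy (hubbardTTPrimeFermionInteraction t t' U) 1 - μ₂ * σ.density)
    (hω₁ : ω₁.IsVarEquilibrium β Γ₁ R₁) (hρ₁ : ω₁.density ≤ m₁) (hω₂ : ω₂.IsVarEquilibrium β Γ₂ R₂) (hρ₂ : m₂ ≤ ω₂.density) :
    g ≤ μ₂ - μ₁ := by
  have k₁ := hω₁.particleHole_of_muShift_reflect t t' U β hΓ₁ (meanEnergy_hubbardTTPrimeMu_eq_sub t (-t') U (U - μ₁))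
  have k₂ := hω₂.particleHole_of_muShift_reflect t t' U β hΓ₂ (meanEnergy_hubbardTTPrimeMu_eq_sub t (-t') U (U - μ₂))
  have hd₁ : 2 - m₁ ≤ ω₁.particleHole.density := by rw [density_particleHole]; linarith
  have hd₂ : ω₂.particleHole.density ≤ 2 - m₂ := by rw [density_particleHole]; linarith
  have h := H k₂ hd₂ k₁ hd₁
  linarith

end Transfer

end InfVolFermionState

end Literature.MathematicalPhysics.QuantumLattice

end
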